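import Summits.KontsevichZagierPeriods.KontsevichZagierPeriods.Theorems.LinRedNormalFormArrangementNormalFormSeparateSplit

/-!
# The numerator split under domination (line `janus-bands`, crux `ArrangementNormalForm`)

`separatePos_split` isolates the analytic content of the last separation step `GG♮ → GG` as the
hypothesis `hI` (termwise absolute convergence of the Taylor split of the numerator). This file
discharges `hI` in the DOMINATED case: if every Taylor term `qᵢ(x') (y − ℓ(x'))^i` is bounded by
`C |P(x', y)|` on the domain (e.g. `P` bounded away from `0` on the closed cell), the `i`-th term
of the split is the parent integrand times the bounded `ℚ`-semialgebraic factor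
`qᵢ (y − ℓ)^i / P`, hence absolutely convergent (`SeparatePos.mulRep`, `Integrable.mul_bdd`).

Main result: `separatePos_split_dominated` (registered sub-goal of `stub_separatePos`). What it
does NOT cover is exactly a numerator vanishing on the closed base cell to an order the Taylor
terms do not share ("`P`-bought convergence", e.g. `P = x² + y² − 1` on `(0, 2)²` with a fibre
letter `1/(t + x)`): there termwise convergence needs a fibre-mass estimate.
-/

noncomputable section

open Set MeasureTheory MvPolynomial

namespace Summit.KontsevichZagierPeriods.ArrangementNormalForm.JanusBands

open Literature.NumberTheory.Transcendental Literature.ModelTheory.ExponentialFields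

open SeparatePos in
/-- **The numerator split, dominated case** (registered sub-goal of `stub_separatePos`): as
`separatePos_split`, with the termwise convergence hypothesis replaced by the domination
`|qᵢ(x') (y − ℓ)^i| ≤ C |P(x', y)|` on the domain for every Taylor term. -/
theorem separatePos_split_dominated (GG : ℕ → ℕ → ℕ → Set KZ.FormalRep) (hGG : ∀ b σ k, GG b σ k = {w : KZ.FormalRep | ∃ (m m' n₁ n₂ : ℕ) (s : KZ.IntegralRep (b + 1 + k)) (M : Fin m' → (Fin (b + 1) → ℚ) × ℚ) (L : Fin m → (Fin b → ℚ) × ℚ) (e : Fin m → ℕ) (p : MvPolynomial (Fin b) ℚ) (ℓ₁ ℓ₂ : (Fin b → ℚ) × ℚ) (a : Fin k → Option ((Fin (b + 1) → ℚ) × ℚ)) (lo hi : Fin k → Fin k ⊕ ((Fin (b + 1) → ℚ) × ℚ)), (n₁ = 0 ∨ n₂ = 0) ∧ (σ = 2 → (∀ i c, a i = some c → c.1 (Fin.last b) = 0) ∧ (∀ i c, (lo i = Sum.inr c ∨ hi i = Sum.inr c) → (c.1 (Fin.last b) = 0 ∨ c = (Pi.single (Fin.last b) 1, 0)))) ∧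 Bornology.IsBounded s.domain ∧ s.domain = {z | (∀ j, 0 < ∑ i, ((M j).1 i : ℝ) * z (Fin.castAdd k i) + ((M j).2 : ℝ)) ∧ ∀ i, Sum.elim (fun j => z (Fin.natAdd (b + 1) j)) (fun c => ∑ i', (c.1 i' : ℝ) * z (Fin.castAdd k i') + (c.2 : ℝ)) (lo i) < z (Fin.natAdd (b + 1) i) ∧ z (Fin.natAdd (b + 1) i) < Sum.elim (fun j => z (Fin.natAdd (b + 1) j)) (fun c => ∑ i', (c.1 i' : ℝ) * z (Fin.castAdd k i') + (c.2 : ℝ)) (hi i)} ∧ EqOn s.integrand (fun z => MvPolynomial.aeval (fun i => z (Fin.castAdd k (Fin.castSucc i))) p / (∏ j, (∑ i, ((L j).1 i : ℝ) * z (Fin.castAdd k (Fin.castSucc i)) + ((L j).2 : ℝ)) ^ e j) * ((z (Fin.castAdd k (Fin.last b)) - (∑ i, (ℓ₁.1 i : ℝ) * z (Fin.castAdd k (Fin.castSucc i)) + (ℓ₁.2 : ℝ))) ^ n₁ / (z (Fin.castAdd k (Fin.last b)) - (∑ i, (ℓ₂.1 i : ℝ) * z (Fin.castAdd k (Fin.castSucc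 i)) + (ℓ₂.2 : ℝ))) ^ n₂) * ∏ i, (a i).elim 1 (fun c => 1 / (z (Fin.natAdd (b + 1) i) - (∑ i', (c.1 i' : ℝ) * z (Fin.castAdd k i') + (c.2 : ℝ))))) s.domain ∧ w = KZ.of s}) (b k m m' n : ℕ) (s : KZ.IntegralRep (b + 1 + k)) (M : Fin m' → (Fin (b + 1) → ℚ) × ℚ) (L : Fin m → (Fin b → ℚ) × ℚ) (e : Fin m → ℕ) (p : MvPolynomial (Fin (b + 1)) ℚ) (ℓ : (Fin b → ℚ) × ℚ) (a : Fin k → Option ((Fin (b + 1) → ℚ) × ℚ)) (lo hi : Fin k → Fin k ⊕ ((Fin (b + 1) → ℚ) × ℚ)) (hpole : n ≠ 0 → ∀ z ∈ s.domain, (z (Fin.castAdd k (Fin.last b)) - (∑ i, (ℓ.1 i : ℝ) * z (Fin.castAdd k (Fin.castSucc i)) + (ℓ.2 : ℝ))) ≠ 0) (hbd : Bornology.IsBounded s.domain) (hdom : s.domain = {z | (∀ j, 0 < ∑ i, ((M j).1 i : ℝ) * z (Fin.castAdd k i) + ((M j).2 : ℝ)) ∧ ∀ i, Sum.elim (fun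 j => z (Fin.natAdd (b + 1) j)) (fun c => ∑ i', (c.1 i' : ℝ) * z (Fin.castAdd k i') + (c.2 : ℝ)) (lo i) < z (Fin.natAdd (b + 1) i) ∧ z (Fin.natAdd (b + 1) i) < Sum.elim (fun j => z (Fin.natAdd (b + 1) j)) (fun c => ∑ i', (c.1 i' : ℝ) * z (Fin.castAdd k i') + (c.2 : ℝ)) (hi i)}) (hint : EqOn s.integrand (fun z => MvPolynomial.aeval (fun i => z (Fin.castAdd k i)) p / (∏ j, (∑ i, ((L j).1 i : ℝ) * z (Fin.castAdd k (Fin.castSucc i)) + ((L j).2 : ℝ)) ^ e j) * (1 / (z (Fin.castAdd k (Fin.last b)) - (∑ i, (ℓ.1 i : ℝ) * z (Fin.castAdd k (Fin.castSucc i)) + (ℓ.2 : ℝ))) ^ n) * ∏ i, (a i).elim 1 (fun c => 1 / (z (Fin.natAdd (b + 1) i) - (∑ i', (c.1 i' : ℝ) * z (Fin.castAdd k i') + (c.2 : ℝ))))) s.domain) (N : ℕ) (q : ℕ → MvPolynomial (Fin b) ℚ) (hq : ∀ z : Fin (b + 1 + k) → ℝ, MvPolynomial.aeval (fun i => z (Fin.castAdd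 k i)) p = ∑ i ∈ Finset.range N, MvPolynomial.aeval (fun i => z (Fin.castAdd k (Fin.castSucc i))) (q i) * (z (Fin.castAdd k (Fin.last b)) - (∑ i, (ℓ.1 i : ℝ) * z (Fin.castAdd k (Fin.castSucc i)) + (ℓ.2 : ℝ))) ^ i) (hdomq : ∀ i ∈ Finset.range N, ∃ C : ℝ, ∀ z ∈ s.domain, |MvPolynomial.aeval (fun i => z (Fin.castAdd k (Fin.castSucc i))) (q i) * (z (Fin.castAdd k (Fin.last b)) - (∑ i, (ℓ.1 i : ℝ) * z (Fin.castAdd k (Fin.castSucc i)) + (ℓ.2 : ℝ))) ^ i| ≤ C * |MvPolynomial.aeval (fun i => z (Fin.castAdd k i)) p|) : ∃ c ∈ AddSubgroup.closure (GG b 1 k), KZ.of s - c ∈ KZ.relations := by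
  refine separatePos_split GG hGG b k m m' n s M L e p ℓ a lo hi hpole hbd hdom hint N q hq
    fun i hi => ?_
  obtain ⟨C, hC⟩ := hdomq i hi
  have hσ := s.isSemialgebraic_domain
  -- the bounded semialgebraic multiplier `qᵢ (y − ℓ)^i / P`
  set g : (Fin (b + 1 + k) → ℝ) → ℝ := fun z => MvPolynomial.aeval (fun i => z (Fin.castAdd k
    (Fin.castSucc i))) (q i) * (z (Fin.castAdd k (Fin.last b)) - affB b k ℓ z) ^ i /
    MvPolynomial.aeval (fun i => z (Fin.castAdd k i)) p with hg
  have hq' : IsSemialgebraicFunOn ℚ s.domain (fun z => MvPolynomial.aeval (fun i => z (Fin.castAdd k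
      (Fin.castSucc i))) (q i)) :=
    (isSemialgebraicFunOn_aeval hσ (rename (fun i => Fin.castAdd k (Fin.castSucc i)) (q i))).congr
      fun z _ => by simp [aeval_rename, Function.comp_def]
  have hu : IsSemialgebraicFunOn ℚ s.domain
      (fun z => z (Fin.castAdd k (Fin.last b)) - affB b k ℓ z) :=
    (isSemialgebraicFunOn_aeval hσ (X (Fin.castAdd k (Fin.last b)) - affPoly b k ℓ)).congr
      fun z _ => by simp [aeval_affPoly]
  have hp' : IsSemialgebraicFunOn ℚ s.domain
      (fun z => MvPolynomial.aeval (fun i => z (Fin.castAdd k i)) p) :=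
    (isSemialgebraicFunOn_aeval hσ (rename (fun i => Fin.castAdd k i) p)).congr
      fun z _ => by simp [aeval_rename, Function.comp_def]
  have hgsa : IsSemialgebraicFunOn ℚ s.domain g :=
    IntegrateOut.isSemialgebraicFunOn_div (IsSemialgebraicFunOn.mul_holds hq'
      (IntegrateOut.isSemialgebraicFunOn_pow hu i)) hp'
  have hgb : ∀ z ∈ s.domain, |g z| ≤ max C 0 := fun z hz => by
    by_cases hpz : MvPolynomial.aeval (fun i => z (Fin.castAdd k i)) p = 0
    · have h0 : g z = 0 := by
        simp only [hg]
        rw [hpz, div_zero]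
      rw [h0, abs_zero]
      exact le_max_right _ _
    · simp only [hg]
      rw [abs_div, div_le_iff₀ (abs_pos.2 hpz)]
      exact (hC z hz).trans (mul_le_mul_of_nonneg_right (le_max_left _ _) (abs_nonneg _))
  refine ((mulRep s g hgsa _ hgb).integrableOn.congr_fun (fun z hz => ?_)
    (KZ.IntegralRep.measurableSet_domain_holds s))
  -- pointwise: parent × multiplier = the `i`-th term
  show s.integrand z * g z = _
  rw [hint hz, hg]
  simp only [affB]
  by_cases hpz : MvPolynomial.aeval (fun i => z (Fin.castAdd k i)) p = 0
  · have h0 : MvPolynomial.aeval (fun i => z (Fin.castAdd k (Fin.castSucc i))) (q i) *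
        (z (Fin.castAdd k (Fin.last b)) - (∑ i, (ℓ.1 i : ℝ) * z (Fin.castAdd k (Fin.castSucc i)) +
          (ℓ.2 : ℝ))) ^ i = 0 := by
      have h := hC z hz
      rw [hpz, abs_zero, mul_zero] at h
      exact abs_eq_zero.1 (le_antisymm h (abs_nonneg _))
    rcases mul_eq_zero.1 h0 with h1 | h1
    · rw [hpz, h1]
      simp only [zero_div, zero_mul, mul_zero]
    · rw [hpz, h1]
      simp only [zero_div, zero_mul, mul_zero, div_zero]
  · have key : ∀ a D un F Q ui : ℝ, a ≠ 0 →
        a / D * (1 / un) * F * (Q * ui / a) = Q / D * (ui / un) * F := by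
      intro a D un F Q ui ha
      calc a / D * (1 / un) * F * (Q * ui / a) = a / a * (Q / D * (ui / un) * F) := by ring
        _ = Q / D * (ui / un) * F := by rw [div_self ha, one_mul]
    exact key _ _ _ _ _ _ hpz

end Summit.KontsevichZagierPeriods.ArrangementNormalForm.JanusBands
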